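import Summits.BirchSwinnertonDyer.BirchSwinnertonDyer.Theorems.TangentConeSelmerRankSmallImageCMKernel

/-!
# BirchSwinnertonDyer / TangentCone, SelmerRank — `SelmerRankSmallImage` (stmt-BirchSwinnertonDyer-14418)
# from the routes' OWN items, nothing else

With the CM sector filed as its own item `SelmerRankCM` (stmt-BirchSwinnertonDyer-18086, a decl of
every wanting route, 2026-08-17) the small-image Selmer-rank statement `SelmerRankSmallImage`
follows from items the routes already carry and NOTHING from the literature — no named fact, no
hypothesis spelled out by hand: every hypothesis below is a route decl BY NAME.

* `tangentCone_selmerRankSmallImage_of_selmerRankCM` — route TangentCone: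
  `EdgeDecay → EdgeCap → SelmerRankLB → SelmerRankShaPFinite → RankLeOne → SelmerRankCM →
  SelmerRankSmallImage` (from `tangentCone_selmerRankSmallImage_of_cmCore`, the line
  `prime-switch` composition: `r_an ≤ 1` by `RankLeOne`, CM by `SelmerRankCM`, non-CM by a Serre
  prime — `exists_goodOrdinary_surjective_of_not_hasCM`, PROVED — the edge anchor there and the
  `Ш`-transfer).
* `selmerRank_selmerRankSmallImage_of_selmerRankCM` — route SelmerRank:
  `SelmerRankUB → SelmerRankLB → SelmerRankShaPFinite → SelmerRankCM → SelmerRankSmallImage`, with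
  NO Gross–Zagier–Kolyvagin input: `UB ∧ LB` give `corank_q = r_an` at the Serre prime in EVERY
  analytic rank, and `SelmerRankShaPFinite` transfers the corank to `p`
  (`selmerCorank_eq_selmerCorank_of_shaPFinite`).

Both are CONDITIONAL (implications between open route statements); they record that item
stmt-BirchSwinnertonDyer-14418 is a pure glue node above stmt-18086 and the routes' big-image /
`Ш` items. Supports stmt-BirchSwinnertonDyer-14418.
-/

-- D-0017: single-problem summit, so `Summit.BirchSwinnertonDyer.BirchSwinnertonDyer.…` repeats a
-- namespace BY DESIGN.
set_option linter.dupNamespace false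

namespace Summit.BirchSwinnertonDyer.BirchSwinnertonDyer.Theorems

open Summit.BirchSwinnertonDyer.BirchSwinnertonDyer.Theses
open Literature.NumberTheory.EllipticCurves

/-- **Route TangentCone: `SelmerRankSmallImage` from the route's own items** `EdgeDecay`,
`EdgeCap`, `SelmerRankLB`, `SelmerRankShaPFinite`, `RankLeOne` and the CM item `SelmerRankCM`
(stmt-18086) — every hypothesis a route decl by name; `SelmerRankCM` (all analytic ranks)
specialises to the line's CM stub (analytic rank `≥ 2`) and `tangentCone_selmerRankSmallImage_of_cmCore`
does the rest. CONDITIONAL. [folklore] -/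
theorem tangentCone_selmerRankSmallImage_of_selmerRankCM :
    Summit.BirchSwinnertonDyer.BirchSwinnertonDyer.Theses.TangentCone.EdgeDecay →
    Summit.BirchSwinnertonDyer.BirchSwinnertonDyer.Theses.TangentCone.EdgeCap →
    Summit.BirchSwinnertonDyer.BirchSwinnertonDyer.Theses.TangentCone.SelmerRankLB →
    Summit.BirchSwinnertonDyer.BirchSwinnertonDyer.Theses.TangentCone.SelmerRankShaPFinite →
    Summit.BirchSwinnertonDyer.BirchSwinnertonDyer.Theses.TangentCone.RankLeOne →
    Summit.BirchSwinnertonDyer.BirchSwinnertonDyer.Theses.TangentCone.SelmerRankCM →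
    Summit.BirchSwinnertonDyer.BirchSwinnertonDyer.Theses.TangentCone.SelmerRankSmallImage :=
  fun hE hC hLB hSha hR1 hCM =>
    tangentCone_selmerRankSmallImage_of_cmCore hE hC hLB hSha hR1
      fun W _ _ p _ h5 hgood hord hW _ => hCM W p h5 hgood hord hW

/-- **Route SelmerRank: `SelmerRankSmallImage` from the route's own items** `SelmerRankUB`,
`SelmerRankLB`, `SelmerRankShaPFinite` and the CM item `SelmerRankCM` (stmt-18086) — every
hypothesis a route decl by name, and NO Gross–Zagier–Kolyvagin: for a CM curve `SelmerRankCM`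
applies at `p` itself; for a non-CM curve a Serre prime `q` (good ordinary, `≥ 5`, surjective
image: `exists_goodOrdinary_surjective_of_not_hasCM`, proved) has `corank_q = r_an` by `UB ∧ LB`
in every analytic rank, and `corank_p = corank_q` by `SelmerRankShaPFinite`
(`selmerCorank_eq_selmerCorank_of_shaPFinite`). CONDITIONAL. [folklore] -/
theorem selmerRank_selmerRankSmallImage_of_selmerRankCM :
    Summit.BirchSwinnertonDyer.BirchSwinnertonDyer.Theses.SelmerRank.SelmerRankUB →
    Summit.BirchSwinnertonDyer.BirchSwinnertonDyer.Theses.SelmerRank.SelmerRankLB →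
    Summit.BirchSwinnertonDyer.BirchSwinnertonDyer.Theses.SelmerRank.SelmerRankShaPFinite →
    Summit.BirchSwinnertonDyer.BirchSwinnertonDyer.Theses.SelmerRank.SelmerRankCM →
    Summit.BirchSwinnertonDyer.BirchSwinnertonDyer.Theses.SelmerRank.SelmerRankSmallImage := by
  intro hUB hLB hSha hCM W _ _ p _ h5 hgood hord _hns
  by_cases hW : W.HasCM
  · exact hCM W p h5 hgood hord hW
  · obtain ⟨q, hq, h5q, hgoodq, hordq, hsurjq⟩ := exists_goodOrdinary_surjective_of_not_hasCM W hW
    rw [selmerCorank_eq_selmerCorank_of_shaPFinite hSha W p q]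
    exact le_antisymm (hUB W q h5q hgoodq hordq hsurjq) (hLB W q h5q hgoodq hordq hsurjq)

end Summit.BirchSwinnertonDyer.BirchSwinnertonDyer.Theorems
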